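import Literature.AlgebraicGeometry.HodgeTheory.RibetTypeTwelveNineteenPowersHodgeClasses
import Literature.AlgebraicGeometry.Motives.HodgeThetaSubalgebraUnitaryFifteenSixteenCore
import HarnessLib

/-!
# Hodge classes on all powers of abelian varieties of Ribet type `(15, 16)` are generated by divisor classes
# (Ribet 1983 Thm. 3 at these multiplicities — UNCONDITIONAL); EVERY SIMPLE COMPLEX ABELIAN 31-FOLD WITH `End⁰ ≠ ℚ`

Family `hodge`, layer `Literature/AlgebraicGeometry/HodgeTheory`. Research context: cell `pub-hodge-ring2` (HONEST
FRAMING: research route conditional on HC_CM; not a corollary; Q11.4-sentence-2 already refuted in dim ≥ 3),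
Literature lane gen 87, programme R75. UNCONDITIONAL for the class of abelian varieties it names; theorems only, no
definition, no named fact (D-0026), no `sorry`. The CELL of the generic assembly `RibetTypeOfCoreSmulPowersHodgeClasses`
at the core `UnitaryFifteenSixteen.eq_top_of_smul` (`Motives/HodgeThetaSubalgebraUnitaryFifteenSixteenCore`: the last
`p = 31` pair, closed by minimal-rank base points and the `XCX` identity), and the census it completes: after
`{14, 17}`, `{8, 23}`, `{9, 22}`, `{10, 21}`, `{12, 19}` the last `k`-signature `{15, 16}` of the prime dimension `31`.

THE PRINTED THEOREM. Ribet, Amer. J. Math. 105 (1983), Thm. 3 = Gordon's survey Thm. 6.3 (3) [held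
`paper:arxiv-alg-geom_9709030` p. 18]: `X` an abelian variety with `End⁰(X) = k` imaginary quadratic acting on
`Lie X` with coprime multiplicities `(n′, n″)` ⟹ `Hg(X) = U(V, φ)` and `B•(Xⁿ) = D•(Xⁿ)` for all `n`.

* §1 the cell `(15, 16)` (and the mirror `'`), the Hodge conjecture for these powers, 31-FOLDS of signature `{15, 16}`.
* §2 **`isDivisorGenerated_powSucc_of_isSimple_thirtyonefold_of_finrank_endAlgebra_ne_one`**: EVERY simple complex
  abelian `31`-fold with `End⁰ ≠ ℚ` has `B• = D•` on all powers, hence satisfies the Hodge conjecture on all powers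
  (Moonen–Zarhin: for a simple abelian variety of prime dimension `End⁰` is `ℚ`, an imaginary quadratic field — then
  Ribet's theorem, every `k`-signature `{n′, 31 − n′}` being coprime — or a CM field of degree `62`).

## References
* [Ribet1983] K. A. Ribet, Amer. J. Math. 105 (1983), Thm. 0 and Thm. 3.
* [Gordon1997] B. B. Gordon, *A survey of the Hodge conjecture for abelian varieties*, Thm. 6.3 (3) and Corollary.
* [MoonenZarhin1999LowDim] B. Moonen, Yu. Zarhin, Math. Ann. 315 (1999), §2 (2.4), Thm. (2.7).
* [Deligne2000] P. Deligne, *The Hodge conjecture* (Clay, 2000), §1.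
-/

noncomputable section

open CategoryTheory Module

namespace Literature.AlgebraicGeometry.HodgeTheory

open Literature.AlgebraicGeometry.Motives
open Literature.AlgebraicGeometry.Motives.HodgeStructure

section Cells

/-- **Ribet 1983 Thm. 3 at `(n′, n″) = (15, 16)` — UNCONDITIONAL** (core `UnitaryFifteenSixteen.eq_top_of_smul`).
[cite: Ribet1983, Thm. 0 and Thm. 3] [cite: Gordon1997, Thm. 6.3 (3) and Corollary] -/
theorem AbelianVariety.isDivisorGenerated_powSucc_of_ribetTypeFifteenSixteen (A : AbelianVariety ℂ) (φ : A ⟶ A)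
    {d : ℕ} (hd : 0 < d) (hφ : φ ≫ φ = -(d • 𝟙 A)) (hE2 : Module.finrank ℚ A.endAlgebra = 2)
    (h15 : eigenMultiplicity A φ (Complex.I * (Real.sqrt d : ℂ)) = 15)
    (h16 : eigenMultiplicity A φ (-(Complex.I * (Real.sqrt d : ℂ))) = 16) (N : ℕ) :
    IsDivisorGenerated (A.powSucc N) := by
  refine AbelianVariety.isDivisorGenerated_powSucc_of_ribetType_ofCoreSmul A φ hd hφ hE2 (by omega) (by omega) ?_ N
  intro W' _ _ _ 𝔊 ι P' Q' s hbr hirr hι hιι hP' hQ' hfinP' hfinQ' hadd hsmul hsymm hPQ hdefP hdefQ hadj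
  exact UnitaryFifteenSixteen.eq_top_of_smul hbr hirr hι hιι hP' hQ' (by rw [hfinP', h15]) (by rw [hfinQ', h16]) hadd
    hsmul hsymm hPQ hdefP hdefQ hadj

/-- The mirror: `n_{i√d}(φ) = 16`, `n_{−i√d}(φ) = 15` (core `UnitaryFifteenSixteen.eq_top_of_smul'`).
[cite: Ribet1983, Thm. 0 and Thm. 3] [cite: Gordon1997, Thm. 6.3 (3) and Corollary] -/
theorem AbelianVariety.isDivisorGenerated_powSucc_of_ribetTypeFifteenSixteen' (A : AbelianVariety ℂ) (φ : A ⟶ A)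
    {d : ℕ} (hd : 0 < d) (hφ : φ ≫ φ = -(d • 𝟙 A)) (hE2 : Module.finrank ℚ A.endAlgebra = 2)
    (h16 : eigenMultiplicity A φ (Complex.I * (Real.sqrt d : ℂ)) = 16)
    (h15 : eigenMultiplicity A φ (-(Complex.I * (Real.sqrt d : ℂ))) = 15) (N : ℕ) :
    IsDivisorGenerated (A.powSucc N) := by
  refine AbelianVariety.isDivisorGenerated_powSucc_of_ribetType_ofCoreSmul A φ hd hφ hE2 (by omega) (by omega) ?_ N
  intro W' _ _ _ 𝔊 ι P' Q' s hbr hirr hι hιι hP' hQ' hfinP' hfinQ' hadd hsmul hsymm hPQ hdefP hdefQ hadj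
  exact UnitaryFifteenSixteen.eq_top_of_smul' hbr hirr hι hιι hP' hQ' (by rw [hfinP', h16]) (by rw [hfinQ', h15]) hadd
    hsmul hsymm hPQ hdefP hdefQ hadj

/-- **The Hodge conjecture for all powers `A^{N+1}` of an abelian variety of Ribet type `(15, 16)` — UNCONDITIONAL.**
[cite: Ribet1983, Thm. 3] [cite: Deligne2000, §1] -/
theorem hodgeConjectureFor_powSucc_of_ribetTypeFifteenSixteen (A : AbelianVariety ℂ) (φ : A ⟶ A)
    {d : ℕ} (hd : 0 < d) (hφ : φ ≫ φ = -(d • 𝟙 A)) (hE2 : Module.finrank ℚ A.endAlgebra = 2)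
    (h15 : eigenMultiplicity A φ (Complex.I * (Real.sqrt d : ℂ)) = 15)
    (h16 : eigenMultiplicity A φ (-(Complex.I * (Real.sqrt d : ℂ))) = 16) (N : ℕ) :
    HodgeConjectureFor (A.powSucc N).dim (A.powSucc N).X :=
  hodgeConjectureFor_of_isDivisorGenerated _
    (AbelianVariety.isDivisorGenerated_powSucc_of_ribetTypeFifteenSixteen A φ hd hφ hE2 h15 h16 N)

/-- **31-FOLDS of signature `{15, 16}`: `B• = D•` on all powers — UNCONDITIONAL** (either eigenvalue may carry the `15`).
[cite: Ribet1983, Thm. 0 and Thm. 3] [cite: MoonenZarhin1999LowDim, §2 (2.4)] -/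
theorem AbelianVariety.isDivisorGenerated_powSucc_of_thirtyonefold_fifteenSixteen (A : AbelianVariety ℂ)
    (φ : A ⟶ A) {d : ℕ} (hd : 0 < d) (hφ : φ ≫ φ = -(d • 𝟙 A)) (hE2 : Module.finrank ℚ A.endAlgebra = 2)
    (hX : A.dim = 31)
    (h15 : eigenMultiplicity A φ (Complex.I * (Real.sqrt d : ℂ)) = 15 ∨
      eigenMultiplicity A φ (-(Complex.I * (Real.sqrt d : ℂ))) = 15)
    (N : ℕ) : IsDivisorGenerated (A.powSucc N) := by
  have hsum := eigenMultiplicity_add_eigenMultiplicity_neg_eq_dim A φ hd hφ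
  rw [hX] at hsum
  rcases h15 with h | h
  · exact AbelianVariety.isDivisorGenerated_powSucc_of_ribetTypeFifteenSixteen A φ hd hφ hE2 h (by omega) N
  · exact AbelianVariety.isDivisorGenerated_powSucc_of_ribetTypeFifteenSixteen' A φ hd hφ hE2 (by omega) h N

/-- **The Hodge conjecture for all powers of a 31-FOLD of signature `{15, 16}` — UNCONDITIONAL.**
[cite: Ribet1983, Thm. 3] [cite: Deligne2000, §1] -/
theorem hodgeConjectureFor_powSucc_of_thirtyonefold_fifteenSixteen (A : AbelianVariety ℂ)
    (φ : A ⟶ A) {d : ℕ} (hd : 0 < d) (hφ : φ ≫ φ = -(d • 𝟙 A)) (hE2 : Module.finrank ℚ A.endAlgebra = 2)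
    (hX : A.dim = 31)
    (h15 : eigenMultiplicity A φ (Complex.I * (Real.sqrt d : ℂ)) = 15 ∨
      eigenMultiplicity A φ (-(Complex.I * (Real.sqrt d : ℂ))) = 15)
    (N : ℕ) : HodgeConjectureFor (A.powSucc N).dim (A.powSucc N).X :=
  hodgeConjectureFor_of_isDivisorGenerated _
    (AbelianVariety.isDivisorGenerated_powSucc_of_thirtyonefold_fifteenSixteen A φ hd hφ hE2 hX h15 N)

end Cells

/-! ### §2 Every simple complex abelian 31-fold with `End⁰ ≠ ℚ` -/

section ThirtyOne

variable {X : AbelianVariety ℂ}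

/-- **`B• = D•` on all powers of a SIMPLE complex abelian `31`-FOLD, granted ONLY the shape `End⁰ = ℚ`.** (The census
`isDivisorGenerated_powSucc_of_isSimple_thirtyonefold'''` with its last imaginary-quadratic input, the `k`-signature
`{15, 16}`, supplied by §1.) [cite: MoonenZarhin1999LowDim, §2 (2.4) and Thm. (2.7)] [cite: Ribet1983, Thms. 0–3]
[cite: Gordon1997, Thm. 6.3 and Corollary] -/
theorem isDivisorGenerated_powSucc_of_isSimple_thirtyonefold'''' (hs : X.IsSimple) (hX : X.dim = 31)
    (h1 : Module.finrank ℚ X.endAlgebra = 1 → ∀ N : ℕ, IsDivisorGenerated (X.powSucc N)) (N : ℕ) :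
    IsDivisorGenerated (X.powSucc N) := by
  refine isDivisorGenerated_powSucc_of_isSimple_thirtyonefold''' hs hX h1 (fun φ d hd hφ he2 hsig N => ?_) N
  have hsum := eigenMultiplicity_add_eigenMultiplicity_neg_eq_dim X φ hd hφ
  rw [hX] at hsum
  rcases hsig with h | h
  · exact AbelianVariety.isDivisorGenerated_powSucc_of_ribetTypeFifteenSixteen X φ hd hφ he2 h (by omega) N
  · exact AbelianVariety.isDivisorGenerated_powSucc_of_ribetTypeFifteenSixteen' X φ hd hφ he2 h (by omega) N

/-- **`B• = D•` on all powers of EVERY SIMPLE complex abelian `31`-FOLD with `End⁰ ≠ ℚ` — UNCONDITIONAL.**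
[cite: MoonenZarhin1999LowDim, §2 (2.4) and Thm. (2.7)] [cite: Ribet1983, Thms. 0–3] -/
theorem isDivisorGenerated_powSucc_of_isSimple_thirtyonefold_of_finrank_endAlgebra_ne_one (hs : X.IsSimple)
    (hX : X.dim = 31) (hne : Module.finrank ℚ X.endAlgebra ≠ 1) (N : ℕ) : IsDivisorGenerated (X.powSucc N) :=
  isDivisorGenerated_powSucc_of_isSimple_thirtyonefold'''' hs hX (fun h => absurd h hne) N

/-- **The Hodge conjecture for all powers of EVERY SIMPLE complex abelian `31`-FOLD with `End⁰ ≠ ℚ` —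
UNCONDITIONAL.** [cite: MoonenZarhin1999LowDim, §2 Thm. (2.7)] [cite: Ribet1983, Thm. 3] [cite: Deligne2000, §1] -/
theorem hodgeConjectureFor_powSucc_of_isSimple_thirtyonefold_of_finrank_endAlgebra_ne_one (hs : X.IsSimple)
    (hX : X.dim = 31) (hne : Module.finrank ℚ X.endAlgebra ≠ 1) (N : ℕ) :
    HodgeConjectureFor (X.powSucc N).dim (X.powSucc N).X :=
  hodgeConjectureFor_of_isDivisorGenerated _
    (isDivisorGenerated_powSucc_of_isSimple_thirtyonefold_of_finrank_endAlgebra_ne_one hs hX hne N)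

end ThirtyOne

end Literature.AlgebraicGeometry.HodgeTheory

end
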